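import Summits.KontsevichZagierPeriods.KontsevichZagierPeriods.Theorems.RootDecompZetaThreeFrontierWordRungTwoP7

/-! # `RootDecompZetaThreeFrontierWordRungTwoP8` — part 8/12 of the mechanical ≤270-line split of `RungTwo.stripped.lean`
(split by the decomp-kz census seat for landing; mathematics unchanged; part 8 continues part 7). -/

noncomputable section

namespace Summit.KontsevichZagierPeriods.RootDecompZetaThreeFrontier.WordLayer
open Set MeasureTheory MvPolynomial
open Literature.NumberTheory.Transcendental
open Summit.KontsevichZagierPeriods.KontsevichZagierPeriods.Theses.RootDecompZetaThreeFrontier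
  (HigherWeightDescent)
open Summit.KontsevichZagierPeriods.KontsevichZagierPeriods.Theses.LinRedNormalForm
  (DihedralNormalForm MzvKernelInKZ HoffmanSpanInKZ HoffmanIndependence)

section CornerLayer
open Literature.ModelTheory.ExponentialFields (IsSemialgebraic)










/-! (private copy of `of_mem_relations_of_integrand_zero` — dedup.landed / split policy; origin part RootDecompZetaThreeFrontierWordRungTwoP1) -/
/-- A representation whose integrand vanishes on its domain is a relation (rule 1b: `f = f + f`). -/
private theorem of_mem_relations_of_integrand_zero {n : ℕ} (z : KZ.IntegralRep n)
    (hz : ∀ x ∈ z.domain, z.integrand x = 0) : KZ.of z ∈ KZ.relations := by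
  have h3 : KZ.of z - KZ.of z - KZ.of z ∈ KZ.relations :=
    KZ.integrandAddRel_subset_relations ⟨n, z, z, z, rfl, rfl, fun x hx => by simp [hz x hx], rfl⟩
  rw [show KZ.of z - KZ.of z - KZ.of z = -KZ.of z by abel] at h3
  exact neg_mem_iff.mp h3

/-! (private copy of `mem_simplex_two_iff` — dedup.landed / split policy; origin part RootDecompZetaThreeFrontierWordRungTwoP1) -/
/-- Membership in `simplex_two_iff`, unfolded. [bookkeeping] -/
private theorem mem_simplex_two_iff (z : Fin 2 → ℝ) :
    z ∈ KZ.openOrderedSimplex 2 ↔ 0 < z 1 ∧ z 1 < z 0 ∧ z 0 < 1 := by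
  constructor
  · rintro ⟨h0, h1, ha⟩
    exact ⟨h0 1, ha (show (0 : Fin 2) < 1 by decide), h1 0⟩
  · rintro ⟨h1, h10, h0⟩
    refine ⟨Fin.forall_fin_two.mpr ⟨h1.trans h10, h1⟩, Fin.forall_fin_two.mpr ⟨h0, h10.trans h0⟩,
      Fin.strictAnti_iff_succ_lt.mpr (Fin.forall_fin_one.mpr ?_)⟩
    simpa using h10

/-! (private copy of `measurableSet_simplex` — dedup.landed / split policy; origin part RootDecompZetaThreeFrontierWordRungTwoP4a) -/
/-- `simplex` is measurable. [bookkeeping] -/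
private theorem measurableSet_simplex (k : ℕ) : MeasurableSet (KZ.openOrderedSimplex k) :=
  IsSemialgebraic.measurableSet_holds (KZ.isSemialgebraic_openOrderedSimplex k)

/-- reduction of the monomial classes to corner classes: induction on `a + d` (cancel against the pole, or peel by rule 1b) -/
theorem mc_mem : ∀ (n a b c d β γ : ℕ), a + d = n → β ≤ a + b + 1 → γ ≤ c + d + 1 →
    ∀ (q : ℚ) (r : KZ.IntegralRep 2), r.domain = KZ.openOrderedSimplex 2 →
      EqOn r.integrand (fun z => (q : ℝ) * mc a b c d β γ z) r.domain →
      ∃ m ∈ AddSubgroup.closure (wordGensLE 2), KZ.of r - m ∈ KZ.relations := by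
  intro n
  induction n with
  | zero =>
    intro a b c d β γ hn h0 h1 q r hd hi
    obtain ⟨rfl, rfl⟩ : a = 0 ∧ d = 0 := by omega
    refine cc_all q (j := b) (k := c) (β := β) (γ := γ) (by omega) (by omega) r hd fun z hz => ?_
    rw [hi hz]
    show (q : ℝ) * mc 0 b c 0 β γ z = (q : ℝ) * cc b c β γ z
    simp only [mc, cc, pow_zero, one_mul, mul_one]
  | succ n ih =>
    intro a b c d β γ hn h0 h1 q r hd hi
    rcases Nat.eq_zero_or_pos a with ha | ha
    · subst ha
      obtain ⟨d', rfl⟩ : ∃ d', d = d' + 1 := ⟨d - 1, by omega⟩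
      rcases Nat.eq_zero_or_pos γ with hγ | hγ
      · -- `γ = 0`: peel `(1-t₁)^{d'+1} = (1-t₁)^{d'} - t₁(1-t₁)^{d'}` (rule 1b, both pieces convergent)
        subst hγ
        refine of_sub_split r (mcRep q 0 b c d' β 0 (by omega) (by omega))
          (mcRep q 0 (b + 1) c d' β 0 (by omega) (by omega)) hd rfl rfl (fun z hz => ?_)
          (ih 0 b c d' β 0 (by omega) (by omega) (by omega) q _ rfl fun _ _ => rfl)
          (ih 0 (b + 1) c d' β 0 (by omega) (by omega) (by omega) q _ rfl fun _ _ => rfl)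
        rw [hi (by rw [hd]; exact hz)]
        show (q : ℝ) * mc 0 b c d' β 0 z = (q : ℝ) * mc 0 b c (d' + 1) β 0 z + (q : ℝ) * mc 0 (b + 1) c d' β 0 z
        simp only [mc]
        ring
      · -- `γ ≥ 1`: cancel one factor `1-t₁`
        obtain ⟨γ', rfl⟩ : ∃ γ', γ = γ' + 1 := ⟨γ - 1, by omega⟩
        refine ih 0 b c d' β γ' (by omega) (by omega) (by omega) q r hd fun z hz => ?_
        rw [hi hz]
        have hz' : z ∈ KZ.openOrderedSimplex 2 := by rw [← hd]; exact hz
        obtain ⟨hz1, h10, hz0⟩ := (mem_simplex_two_iff z).1 hz'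
        have h1' : (1 : ℝ) - z 1 ≠ 0 := by linarith
        have h0' : z 0 ≠ 0 := (hz1.trans h10).ne'
        show (q : ℝ) * mc 0 b c (d' + 1) β (γ' + 1) z = (q : ℝ) * mc 0 b c d' β γ' z
        simp only [mc]
        congr 1
        rw [div_eq_div_iff (by positivity) (by positivity)]
        ring
    · obtain ⟨a', rfl⟩ : ∃ a', a = a' + 1 := ⟨a - 1, by omega⟩
      rcases Nat.eq_zero_or_pos β with hβ | hβ
      · -- `β = 0`: peel `t₀^{a'+1} = t₀^{a'} - t₀^{a'}(1-t₀)` (rule 1b, both pieces convergent)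
        subst hβ
        refine of_sub_split r (mcRep q a' b c d 0 γ (by omega) (by omega))
          (mcRep q a' b (c + 1) d 0 γ (by omega) (by omega)) hd rfl rfl (fun z hz => ?_)
          (ih a' b c d 0 γ (by omega) (by omega) (by omega) q _ rfl fun _ _ => rfl)
          (ih a' b (c + 1) d 0 γ (by omega) (by omega) (by omega) q _ rfl fun _ _ => rfl)
        rw [hi (by rw [hd]; exact hz)]
        show (q : ℝ) * mc a' b c d 0 γ z = (q : ℝ) * mc (a' + 1) b c d 0 γ z + (q : ℝ) * mc a' b (c + 1) d 0 γ z
        simp only [mc]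
        ring
      · -- `β ≥ 1`: cancel one factor `t₀`
        obtain ⟨β', rfl⟩ : ∃ β', β = β' + 1 := ⟨β - 1, by omega⟩
        refine ih a' b c d β' γ (by omega) (by omega) (by omega) q r hd fun z hz => ?_
        rw [hi hz]
        have hz' : z ∈ KZ.openOrderedSimplex 2 := by rw [← hd]; exact hz
        obtain ⟨hz1, h10, hz0⟩ := (mem_simplex_two_iff z).1 hz'
        have h1' : (1 : ℝ) - z 1 ≠ 0 := by linarith
        have h0' : z 0 ≠ 0 := (hz1.trans h10).ne'
        show (q : ℝ) * mc (a' + 1) b c d (β' + 1) γ z = (q : ℝ) * mc a' b c d β' γ z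
        simp only [mc]
        congr 1
        rw [div_eq_div_iff (by positivity) (by positivity)]
        ring

/-- **all monomial classes**: every `q·M(a,b,c,d;β,γ)` with `β ≤ a+b+1`, `γ ≤ c+d+1` lies in the weight-`≤ 2` word span modulo relations -/
theorem mc_all (q : ℚ) {a b c d β γ : ℕ} (h0 : β ≤ a + b + 1) (h1 : γ ≤ c + d + 1) (r : KZ.IntegralRep 2)
    (hd : r.domain = KZ.openOrderedSimplex 2) (hi : EqOn r.integrand (fun z => (q : ℝ) * mc a b c d β γ z) r.domain) :
    ∃ m ∈ AddSubgroup.closure (wordGensLE 2), KZ.of r - m ∈ KZ.relations :=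
  mc_mem _ a b c d β γ rfl h0 h1 q r hd hi

/-- finite sums (rule 1b iterated): a family of semialgebraic integrable functions on `Δ₂` whose representations lie in the span has
a semialgebraic integrable sum whose representations lie in the span -/
theorem sum_pack {ι : Type*} (T : Finset ι) (f : ι → (Fin 2 → ℝ) → ℝ)
    (hsa : ∀ i ∈ T, IsSemialgebraicFunOn ℚ (KZ.openOrderedSimplex 2) (f i))
    (hint : ∀ i ∈ T, IntegrableOn (f i) (KZ.openOrderedSimplex 2))
    (hmem : ∀ i ∈ T, ∀ (r : KZ.IntegralRep 2), r.domain = KZ.openOrderedSimplex 2 →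
      EqOn r.integrand (f i) r.domain → ∃ m ∈ AddSubgroup.closure (wordGensLE 2), KZ.of r - m ∈ KZ.relations) :
    IsSemialgebraicFunOn ℚ (KZ.openOrderedSimplex 2) (fun z => ∑ i ∈ T, f i z) ∧
    IntegrableOn (fun z => ∑ i ∈ T, f i z) (KZ.openOrderedSimplex 2) ∧
    ∀ (r : KZ.IntegralRep 2), r.domain = KZ.openOrderedSimplex 2 →
      EqOn r.integrand (fun z => ∑ i ∈ T, f i z) r.domain →
      ∃ m ∈ AddSubgroup.closure (wordGensLE 2), KZ.of r - m ∈ KZ.relations := by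
  classical
  induction T using Finset.induction_on with
  | empty =>
    refine ⟨(isSemialgebraicFunOn_aeval (KZ.isSemialgebraic_openOrderedSimplex 2) (0 : MvPolynomial (Fin 2) ℚ)).congr
      fun z _ => by simp, by simp, fun r hd hi => ⟨0, zero_mem _, ?_⟩⟩
    rw [sub_zero]
    exact of_mem_relations_of_integrand_zero r fun z hz => by rw [hi hz]; simp
  | insert a T haT ih =>
    obtain ⟨hsaT, hintT, hmemT⟩ := ih (fun i hi => hsa i (Finset.mem_insert_of_mem hi))
      (fun i hi => hint i (Finset.mem_insert_of_mem hi)) (fun i hi => hmem i (Finset.mem_insert_of_mem hi))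
    have hsa' : IsSemialgebraicFunOn ℚ (KZ.openOrderedSimplex 2) (fun z => ∑ i ∈ insert a T, f i z) :=
      (IsSemialgebraicFunOn.add_holds (hsa a (Finset.mem_insert_self a T)) hsaT).congr fun z _ => by
        simp only [Pi.add_apply, Finset.sum_insert haT]
    have hint' : IntegrableOn (fun z => ∑ i ∈ insert a T, f i z) (KZ.openOrderedSimplex 2) :=
      ((hint a (Finset.mem_insert_self a T)).add hintT).congr_fun
        (fun z _ => by simp only [Pi.add_apply, Finset.sum_insert haT]) (measurableSet_simplex 2)
    refine ⟨hsa', hint', fun r hd hi => ?_⟩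
    refine of_add_split r (repTwo (f a) (hsa a (Finset.mem_insert_self a T)) (hint a (Finset.mem_insert_self a T)))
      (repTwo _ hsaT hintT) hd rfl rfl (fun z hz => ?_)
      (hmem a (Finset.mem_insert_self a T) _ rfl fun _ _ => rfl) (hmemT _ rfl fun _ _ => rfl)
    rw [hi (by rw [hd]; exact hz)]
    show ∑ i ∈ insert a T, f i z = f a z + ∑ i ∈ T, f i z
    rw [Finset.sum_insert haT]

/-- the change of basis `tᵢ ↦ 1 - tᵢ` (both variables) of `ℚ[t₀,t₁]` -/
def flipXY : MvPolynomial (Fin 2) ℚ →ₐ[ℚ] MvPolynomial (Fin 2) ℚ :=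
  MvPolynomial.bind₁ ![MvPolynomial.C 1 - MvPolynomial.X 0, MvPolynomial.C 1 - MvPolynomial.X 1]

/-- Auxiliary step `flipXY_flipXY`. [bookkeeping] -/
theorem flipXY_flipXY (p : MvPolynomial (Fin 2) ℚ) : flipXY (flipXY p) = p := by
  have h : flipXY.comp flipXY = AlgHom.id ℚ _ := MvPolynomial.algHom_ext fun i => by
    fin_cases i <;> simp [flipXY, MvPolynomial.bind₁_X_right]
  exact AlgHom.congr_fun h p

/-- every polynomial is a `ℚ`-combination of the products `(1-t₀)^{u₀}(1-t₁)^{u₁}`, read off from `flipXY p` … -/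
theorem aeval_eq_sum_flipXY (p : MvPolynomial (Fin 2) ℚ) (t : Fin 2 → ℝ) :
    MvPolynomial.aeval t p = ∑ m ∈ (flipXY p).support,
      ((MvPolynomial.coeff m (flipXY p) : ℚ) : ℝ) * ((1 - t 0) ^ (m 0) * (1 - t 1) ^ (m 1)) := by
  conv_lhs => rw [← flipXY_flipXY p]
  rw [flipXY, MvPolynomial.aeval_bind₁, MvPolynomial.aeval_def, MvPolynomial.eval₂_eq']
  refine Finset.sum_congr rfl fun m _ => ?_
  simp [Fin.prod_univ_two, eq_ratCast]

/-- … and of the monomials `t₀^{s₀}t₁^{s₁}` -/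
theorem aeval_eq_sum_std (p : MvPolynomial (Fin 2) ℚ) (t : Fin 2 → ℝ) :
    MvPolynomial.aeval t p = ∑ m ∈ p.support, ((MvPolynomial.coeff m p : ℚ) : ℝ) * (t 0 ^ (m 0) * t 1 ^ (m 1)) := by
  rw [MvPolynomial.aeval_def, MvPolynomial.eval₂_eq']
  refine Finset.sum_congr rfl fun m _ => ?_
  simp [Fin.prod_univ_two, eq_ratCast]

/-- **THE CORNER LAYER OF RUNG 2, DECIDED.**  If `P ∈ ℚ[t₀,t₁]` vanishes to order `≥ β-1` at `(0,0)` (every monomial of `P` has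
degree `≥ β-1`) and to order `≥ γ-1` at `(1,1)` (every monomial of `P(1-s₀,1-s₁)` has degree `≥ γ-1`) — by §21 these are exactly the
absolutely convergent `[Δ₂, P/(t₀^β(1-t₁)^γ)]` — then every representation of `P/(t₀^β(1-t₁)^γ)` on `Δ₂` lies in the weight-`≤ 2` word span
`ℚ·[pt] + ℚ·[Δ₁,ω_ε] + ℚ·[Δ₂,ω₀ω₁]` modulo `KZ.relations`, by finitely many rule-1b / 2 / 3 moves between absolutely convergent representations.
[Kontsevich–Zagier 2001 §1.2; this file §15, §16, §19] -/
theorem cornerLayer_two (p : MvPolynomial (Fin 2) ℚ) (β γ : ℕ)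
    (h0 : ∀ s ∈ p.support, β ≤ s 0 + s 1 + 1) (h1 : ∀ s ∈ (flipXY p).support, γ ≤ s 0 + s 1 + 1)
    (r : KZ.IntegralRep 2) (hd : r.domain = KZ.openOrderedSimplex 2)
    (hi : EqOn r.integrand (fun t => MvPolynomial.aeval t p / (t 0 ^ β * (1 - t 1) ^ γ)) r.domain) :
    ∃ m ∈ AddSubgroup.closure (wordGensLE 2), KZ.of r - m ∈ KZ.relations := by
  -- the partition of unity `1 = (t₀ + (1-t₀))^N`
  set N : ℕ := (β - 1) + (γ - 1) with hN
  set T₁ : Finset ℕ := (Finset.range (N + 1)).filter (fun i => β ≤ i + 1) with hT₁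
  set T₂ : Finset ℕ := (Finset.range (N + 1)).filter (fun i => ¬ β ≤ i + 1) with hT₂
  set g₁ : ℕ → (Fin 2 → ℝ) → ℝ := fun i z => ∑ u ∈ (flipXY p).support,
    (((N.choose i : ℚ) * MvPolynomial.coeff u (flipXY p) : ℚ) : ℝ) * mc i 0 (N - i + u 0) (u 1) β γ z with hg₁
  set g₂ : ℕ → (Fin 2 → ℝ) → ℝ := fun i z => ∑ s ∈ p.support,
    (((N.choose i : ℚ) * MvPolynomial.coeff s p : ℚ) : ℝ) * mc (i + s 0) (s 1) (N - i) 0 β γ z with hg₂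
  -- the `(0,0)`-safe terms, read in the flipped basis: monomial classes `M(i,0,N-i+u₀,u₁;β,γ)`
  have pack₁ : ∀ i ∈ T₁, IsSemialgebraicFunOn ℚ (KZ.openOrderedSimplex 2) (g₁ i) ∧
      IntegrableOn (g₁ i) (KZ.openOrderedSimplex 2) ∧ ∀ (r : KZ.IntegralRep 2), r.domain = KZ.openOrderedSimplex 2 →
      EqOn r.integrand (g₁ i) r.domain → ∃ m ∈ AddSubgroup.closure (wordGensLE 2), KZ.of r - m ∈ KZ.relations := by
    intro i hi
    have hβi : β ≤ i + 1 := (Finset.mem_filter.1 hi).2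
    exact sum_pack (flipXY p).support
      (fun u z => (((N.choose i : ℚ) * MvPolynomial.coeff u (flipXY p) : ℚ) : ℝ) * mc i 0 (N - i + u 0) (u 1) β γ z)
      (fun u _ => mc_sa _ _ _ _ _ _ _) (fun u hu => mc_integrableOn _ (by omega) (by have := h1 u hu; omega))
      (fun u hu r' hd' hi' => mc_all _ (by omega) (by have := h1 u hu; omega) r' hd' hi')
  -- the `(1,1)`-safe terms, read in the standard basis: monomial classes `M(i+s₀,s₁,N-i,0;β,γ)`
  have pack₂ : ∀ i ∈ T₂, IsSemialgebraicFunOn ℚ (KZ.openOrderedSimplex 2) (g₂ i) ∧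
      IntegrableOn (g₂ i) (KZ.openOrderedSimplex 2) ∧ ∀ (r : KZ.IntegralRep 2), r.domain = KZ.openOrderedSimplex 2 →
      EqOn r.integrand (g₂ i) r.domain → ∃ m ∈ AddSubgroup.closure (wordGensLE 2), KZ.of r - m ∈ KZ.relations := by
    intro i hi
    have hi' := Finset.mem_filter.1 hi
    have hiN : i < N + 1 := Finset.mem_range.1 hi'.1
    have hβi : ¬ β ≤ i + 1 := hi'.2
    exact sum_pack p.support
      (fun s z => (((N.choose i : ℚ) * MvPolynomial.coeff s p : ℚ) : ℝ) * mc (i + s 0) (s 1) (N - i) 0 β γ z)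
      (fun s _ => mc_sa _ _ _ _ _ _ _) (fun s hs => mc_integrableOn _ (by have := h0 s hs; omega) (by omega))
      (fun s hs r' hd' hi' => mc_all _ (by have := h0 s hs; omega) (by omega) r' hd' hi')
  obtain ⟨hG₁sa, hG₁int, hG₁mem⟩ := sum_pack T₁ g₁ (fun i hi => (pack₁ i hi).1) (fun i hi => (pack₁ i hi).2.1)
    (fun i hi => (pack₁ i hi).2.2)
  obtain ⟨hG₂sa, hG₂int, hG₂mem⟩ := sum_pack T₂ g₂ (fun i hi => (pack₂ i hi).1) (fun i hi => (pack₂ i hi).2.1)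
    (fun i hi => (pack₂ i hi).2.2)
  refine of_add_split r (repTwo _ hG₁sa hG₁int) (repTwo _ hG₂sa hG₂int) hd rfl rfl (fun z hz => ?_)
    (hG₁mem _ rfl fun _ _ => rfl) (hG₂mem _ rfl fun _ _ => rfl)
  -- the pointwise identity on `Δ₂`
  rw [hi (by rw [hd]; exact hz)]
  show MvPolynomial.aeval z p / (z 0 ^ β * (1 - z 1) ^ γ) = (∑ i ∈ T₁, g₁ i z) + ∑ i ∈ T₂, g₂ i z
  have k₁ : ∀ i, g₁ i z = ((N.choose i : ℝ) * z 0 ^ i * (1 - z 0) ^ (N - i)) *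
      (MvPolynomial.aeval z p / (z 0 ^ β * (1 - z 1) ^ γ)) := fun i => by
    simp only [hg₁, mc, mul_div_assoc']
    rw [← Finset.sum_div]
    congr 1
    rw [aeval_eq_sum_flipXY p z, Finset.mul_sum]
    refine Finset.sum_congr rfl fun u _ => ?_
    push_cast
    ring
  have k₂ : ∀ i, g₂ i z = ((N.choose i : ℝ) * z 0 ^ i * (1 - z 0) ^ (N - i)) *
      (MvPolynomial.aeval z p / (z 0 ^ β * (1 - z 1) ^ γ)) := fun i => by
    simp only [hg₂, mc, mul_div_assoc']
    rw [← Finset.sum_div]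
    congr 1
    rw [aeval_eq_sum_std p z, Finset.mul_sum]
    refine Finset.sum_congr rfl fun s _ => ?_
    push_cast
    ring
  rw [Finset.sum_congr rfl fun i _ => k₁ i, Finset.sum_congr rfl fun i _ => k₂ i, hT₁, hT₂,
    Finset.sum_filter_add_sum_filter_not, ← Finset.sum_mul]
  have hsum : ∑ i ∈ Finset.range (N + 1), (N.choose i : ℝ) * z 0 ^ i * (1 - z 0) ^ (N - i) = 1 :=
    calc ∑ i ∈ Finset.range (N + 1), (N.choose i : ℝ) * z 0 ^ i * (1 - z 0) ^ (N - i)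
        = ∑ i ∈ Finset.range (N + 1), z 0 ^ i * (1 - z 0) ^ (N - i) * (N.choose i : ℝ) :=
          Finset.sum_congr rfl fun i _ => by ring
      _ = (z 0 + (1 - z 0)) ^ N := (add_pow _ _ _).symm
      _ = 1 := by simp
  rw [hsum, one_mul]

end CornerLayer
/-! ## §21  NECESSITY AND THE RUNG `K = 2` IN FULL (gen 10): integrability of a genus-zero datum on `Δ₂` FORCES the three face
factors `t₁^{b₁}`, `(t₀-t₁)^{a}`, `(1-t₀)^{c₀}` to cancel into the numerator and the corner orders `β ≤ ord_{(0,0)}P + 1`,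
`γ ≤ ord_{(1,1)}P + 1` — so §20 applies to EVERY integrable genus-zero representation of dimension `2`: `gzNormalFormW_two`.
ONE face lemma does all the work: if `P(y)/(y₁^b·D(y))` is integrable on a cell `B` fibred over `Δ₁` by intervals `(0, ℓ(x))` in the
last coordinate, `D` continuous and non-zero at the face `y₁ = 0`, then `y₁^b ∣ P` (Fubini §14b; pole test §12a on each section; a
univariate polynomial vanishing at a.e. point of `Δ₁` is zero).  The faces `t₁ = t₀` and `t₀ = 1` are carried to `t₁ = 0` by the shear
`τ(t₀,t₁) = (t₀,t₀-t₁)` and the duality `σ`; the corners are the face `t = 0` of the square under the polynomial chart `Ψ(s,t) = (t,ts)`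
(blow-up of `(0,0)`; `σ∘Ψ` for `(1,1)`).  No move of the calculus is used in this section: it is analysis of the integrability field. -/

end Summit.KontsevichZagierPeriods.RootDecompZetaThreeFrontier.WordLayer
end
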